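/-
Copyright (c) 2026 the pub-hodgecm-mathlib formalisation cell (harness21).  Prover seat hodgecm-mathlib-B-p10 (g26) — ROAD W owner from 11:05Z (heir of B-p14 (g32)), 2026-09-01.
«EP-ROAD-W JUNCTION»: the letter (R2) `RankOneEulerPoincareNonsplit` from the two Kottwitz relations (E) and (N) at SOME vertex∕edge level pair at every ramified non-split place.
-/
import Literature.NumberTheory.Rogawski1990.RankOneEulerPoincareNonsplitOfRamified        -- ★ (B-p14 g32) p843527: `rankOneEulerPoincareNonsplit_of_ramified`
import Literature.NumberTheory.Rogawski1990.RankOneEulerPoincareNonsplitRamifiedPackage    -- ★ (B-p14 g32) p843499: `exists_isLocSmooth_classOrbitalIntegral_eq_one_zero_of_vertexEdgeLevels`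
import HarnessLib

/-!
# The rank-one Euler–Poincaré letter (R2) from the relations (E) and (N) at the ramified places — the ROAD W junction

Topic `NumberTheory/Rogawski1990`, namespace `Literature.NumberTheory.Rogawski1990`.  ONE public THEOREM (+ one private lemma): no definition, no named fact, no
instance, no notation, no `sorry`; kernel lane.  Cell `pub/hodgecm-mathlib` (D-0151), crux H413 = `stmt-HodgeConjecture-24833`, line «N6nsGerm», stub
`stub_N6nsR2EP : RankOneEulerPoincareNonsplit` (pen F0P2-p02 (g9)); LEAD F0P3a-plan (g10) T9-19 (3) ∕ T9-20; ROAD W («R2EP-wild», F0P3a-p04 (g13) MEMO; owner B-p14 (g32) →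
B-p10 (g26) 10:53:17Z).  HONEST LABEL: HC_CM is proved only modulo the cell's remaining named inputs (hLiu418, h413) until rung 0 closes; this file is unconditional
(its hypothesis is a binder, not a `sorry`), and (R2) itself is a PRINTED theorem [Kottwitz1988, §2 Thm. 2].

THE JUNCTION (statement-first skeleton of the ROAD W FOLD, ★-only inputs).  ★ `rankOneEulerPoincareNonsplit_of_ramified` (p843527) reduces the letter to its per-place body
at the RAMIFIED non-split places; ★ `exists_isLocSmooth_classOrbitalIntegral_eq_one_zero_of_vertexEdgeLevels` (p843499) builds that body from Kottwitz's two relations at the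
levels `(K♯_D, K, K♯_D ⊓ K)` for ANY `D ∈ GL₂(L_w)`: (E) `#Fix(U₂⧸K♯_D) + #Fix(U₂⧸K) = #Fix(U₂⧸(K♯_D ⊓ K)) + 1` at regular ELLIPTIC `γ` (measure-free) and (N) the vanishing of the
`ν`-normalised combination of the three unit orbital integrals at regular NON-elliptic `γ` (for every two-sided Haar `ν` and canonical `m`).  HENCE:
**`rankOneEulerPoincareNonsplit_of_ramified_relations`** — if at every non-split `v` RAMIFIED in `L` (`e(w|v) ≠ 1`, the place `w ∣ v` with `w̄ = w` in hand) SOME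
`D ∈ GL₂(L_w)` carries (E) and (N), then `RankOneEulerPoincareNonsplit`.  This is the socket the road's last two bricks plug into by `exact`: (E) = ★ B-p14 p843743
`epEllipticRelation_vertexEdgeLevels_of_vertexAction_local{,'}` over B-p08 (g28)'s (W1c-B)∕(W2) tree action and stabiliser iffs (type `√π`: `K♯_D` vertex ∕ `K` edge;
type `√u`: swapped; the type and an anti-fixed `α` from ★ B-p14 p843768), (N) = A-p06 (g28)'s (W6-N) over the same action (★ F0P2-p02 THEOREM C p843769 per period).
No `IsUnit 2` anywhere: wild places included (ROAD W's point); the tame package ★ p843559 (`hNtame`, B-p04 (g35) (S8b)) becomes a twin, not a dependency.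
The private lemma `ramificationIdx'_ne_one_…` (`¬ IsUnramifiedIn ⇒ e(w|v) ≠ 1` at the unique place above) is re-proved here, as in ★ p843559, to keep the import cone small.

## References
* [Kottwitz1988] R. E. Kottwitz, *Tamagawa numbers*, Ann. of Math. 127 (1988), 629–646, §2 Theorem 2.
* [Rogawski1990] J. D. Rogawski, *Automorphic Representations of Unitary Groups in Three Variables* (1990), §12.6 p. 174; §12.7 Lemma 12.7.1 p. 176.
* [Serre1980Trees] J.-P. Serre, *Trees* (1980), Ch. II §1.1–§1.3.
* [NeukirchANT1999] J. Neukirch, *Algebraic Number Theory* (1999), Ch. I §8 Prop. 8.2.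
-/

set_option autoImplicit false

noncomputable section

open scoped ValuativeRel Matrix MatrixGroups
open Matrix ValuativeRel NumberField IsDedekindDomain MulAction MeasureTheory Measure

namespace Literature.NumberTheory.Rogawski1990

open Literature.NumberTheory.Automorphic Literature.NumberTheory.Automorphic.UnitaryGroup Literature.NumberTheory.GaloisRepresentations

/-! ## §1 `e(w|v) ≠ 1` at the place above a ramified non-split `v` -/

/-- **At a non-split `v` ramified in `L`, `e(w|v) ≠ 1` for the place `w ∣ v`** (`w` is the only prime above `v`; Mathlib `Algebra.IsUnramifiedIn` = every prime above is
unramified).  Private twin of the same lemma in ★ p843559 (kept private there too). [cite: NeukirchANT1999, Ch. I §8 Prop. (8.2)] -/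
private theorem ramificationIdx'_ne_one_of_not_isUnramifiedIn_of_smul_eq' (L : Type) [Field L] [NumberField L] [IsCMField L]
    {v : HeightOneSpectrum (𝓞 ↥(maximalRealSubfield L))} (w : UnitaryGroup.PlacesOver L v) (hw : IsCMField.complexConj L • w.1 = w.1)
    (hram : ¬ Algebra.IsUnramifiedIn (𝓞 L) v.asIdeal) : v.asIdeal.ramificationIdx' w.1.asIdeal ≠ 1 := by
  haveI : Algebra.IsQuadraticExtension ↥(maximalRealSubfield L) L := IsCMField.isQuadraticExtension L
  intro he
  apply hram
  intro P hP hPover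
  have hP0 : P ≠ ⊥ := Ideal.ne_bot_of_liesOver_of_ne_bot v.ne_bot P
  have hPw : P = w.1.asIdeal :=
    congrArg (fun u : UnitaryGroup.PlacesOver L v => u.1.asIdeal)
      (UnitaryGroup.PlacesOver.eq_of_smul_eq (IsCMField.complexConj L) (IsCMField.complexConj_ne_one L) w hw
        ⟨⟨P, hP, hP0⟩, HeightOneSpectrum.ext hPover.over.symm⟩)
  subst hPw
  haveI : v.asIdeal.IsMaximal := v.isMaximal
  rw [← Ideal.ramificationIdx_eq_one_iff, ← Ideal.ramificationIdx'_eq_ramificationIdx v.asIdeal w.1.asIdeal v.ne_bot]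
  exact he

/-! ## §2 The junction -/

/-- **(R2) FROM (E) AND (N) AT THE RAMIFIED PLACES — THE ROAD W JUNCTION.**  If at every non-split place `v` of `L⁺` RAMIFIED in the CM field `L` (`e(w|v) ≠ 1`,
`w ∣ v`, `w̄ = w`) some `D ∈ GL₂(L_w)` satisfies Kottwitz's ELLIPTIC relation (E) at the levels `(K♯_D, K, K♯_D ⊓ K)` of `U₂ = U(Φ₂)(L⁺_v)` and, for every two-sided Haar
`ν` and canonical `m`, the NON-ELLIPTIC relation (N) at the same levels (tokens of ★ `exists_epRelations_of_vertexEdgeLevels` VERBATIM), then the letter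
`RankOneEulerPoincareNonsplit` holds. [cite: Kottwitz1988, §2 Theorem 2] [cite: Rogawski1990, §12.6 p. 174; §12.7 Lemma 12.7.1 p. 176] [cite: Serre1980Trees, II.1.3] -/
theorem rankOneEulerPoincareNonsplit_of_ramified_relations
    (hEN : ∀ (L : Type) [Field L] [NumberField L] [IsCMField L] (v : HeightOneSpectrum (𝓞 ↥(maximalRealSubfield L)))
      (w : UnitaryGroup.PlacesOver L v) (hw : IsCMField.complexConj L • w.1 = w.1),
      v.asIdeal.ramificationIdx' w.1.asIdeal ≠ 1 →
      ∃ D : GL (Fin 2) (w.1.adicCompletion L),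
        (∀ γ : (cmDatum L 2 (Matrix.of fun i j : Fin 2 => if i.val + j.val + 1 = 2 then (1 : L) else 0)).Local v,
      IsRegularElt (γ.val : GL (Fin 2) (UnitaryGroup.LocalRing L v)) →
      CompactSpace (Subgroup.centralizer ({γ} : Set ((cmDatum L 2 (Matrix.of fun i j : Fin 2 => if i.val + j.val + 1 = 2 then (1 : L) else 0)).Local v))) →
      Nat.card (fixedBy ((cmDatum L 2 (Matrix.of fun i j : Fin 2 => if i.val + j.val + 1 = 2 then (1 : L) else 0)).Local v ⧸
          (((glInt 2 (w.1.adicCompletion L)).map (MulAut.conj D).toMonoidHom).comap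
          (((unitaryGroupOfForm (galAdicCompletionMap (L := L) (IsCMField.complexConj L) hw)
            (placeForm (Matrix.of fun i j : Fin 2 => if i.val + j.val + 1 = 2 then (1 : L) else 0) w.1)).subtype.comp
            (localNonsplitEquiv (IsCMField.complexConj L) (Matrix.of fun i j : Fin 2 => if i.val + j.val + 1 = 2 then (1 : L) else 0)
          (IsCMField.complexConj_ne_one L) w hw).toMonoidHom :
            (cmDatum L 2 (Matrix.of fun i j : Fin 2 => if i.val + j.val + 1 = 2 then (1 : L) else 0)).Local v →* GL (Fin 2) (w.1.adicCompletion L))))) γ) +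
        Nat.card (fixedBy ((cmDatum L 2 (Matrix.of fun i j : Fin 2 => if i.val + j.val + 1 = 2 then (1 : L) else 0)).Local v ⧸
          cmLocalIntegralLevel L 2 (Matrix.of fun i j : Fin 2 => if i.val + j.val + 1 = 2 then (1 : L) else 0) v) γ) =
        Nat.card (fixedBy ((cmDatum L 2 (Matrix.of fun i j : Fin 2 => if i.val + j.val + 1 = 2 then (1 : L) else 0)).Local v ⧸
          ((((glInt 2 (w.1.adicCompletion L)).map (MulAut.conj D).toMonoidHom).comap
          (((unitaryGroupOfForm (galAdicCompletionMap (L := L) (IsCMField.complexConj L) hw)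
            (placeForm (Matrix.of fun i j : Fin 2 => if i.val + j.val + 1 = 2 then (1 : L) else 0) w.1)).subtype.comp
            (localNonsplitEquiv (IsCMField.complexConj L) (Matrix.of fun i j : Fin 2 => if i.val + j.val + 1 = 2 then (1 : L) else 0)
          (IsCMField.complexConj_ne_one L) w hw).toMonoidHom :
            (cmDatum L 2 (Matrix.of fun i j : Fin 2 => if i.val + j.val + 1 = 2 then (1 : L) else 0)).Local v →* GL (Fin 2) (w.1.adicCompletion L)))) ⊓
            cmLocalIntegralLevel L 2 (Matrix.of fun i j : Fin 2 => if i.val + j.val + 1 = 2 then (1 : L) else 0) v)) γ) + 1) ∧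
        ∀ [MeasurableSpace ((UnitaryGroup.cmDatum L 2 (Matrix.of fun i j : Fin 2 => if i.val + j.val + 1 = 2 then (1 : L) else 0)).Local v)]
          [BorelSpace ((UnitaryGroup.cmDatum L 2 (Matrix.of fun i j : Fin 2 => if i.val + j.val + 1 = 2 then (1 : L) else 0)).Local v)]
          (ν : Measure ((UnitaryGroup.cmDatum L 2 (Matrix.of fun i j : Fin 2 => if i.val + j.val + 1 = 2 then (1 : L) else 0)).Local v))
          [ν.IsHaarMeasure] [ν.IsMulRightInvariant]
          [_iZ : ∀ γ : (UnitaryGroup.cmDatum L 2 (Matrix.of fun i j : Fin 2 => if i.val + j.val + 1 = 2 then (1 : L) else 0)).Local v,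
            MeasurableSpace (((UnitaryGroup.cmDatum L 2 (Matrix.of fun i j : Fin 2 => if i.val + j.val + 1 = 2 then (1 : L) else 0)).Local v) ⧸
              Subgroup.centralizer ({γ} : Set ((UnitaryGroup.cmDatum L 2 (Matrix.of fun i j : Fin 2 => if i.val + j.val + 1 = 2 then (1 : L) else 0)).Local v)))]
          [_bZ : ∀ γ : (UnitaryGroup.cmDatum L 2 (Matrix.of fun i j : Fin 2 => if i.val + j.val + 1 = 2 then (1 : L) else 0)).Local v,
            BorelSpace (((UnitaryGroup.cmDatum L 2 (Matrix.of fun i j : Fin 2 => if i.val + j.val + 1 = 2 then (1 : L) else 0)).Local v) ⧸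
              Subgroup.centralizer ({γ} : Set ((UnitaryGroup.cmDatum L 2 (Matrix.of fun i j : Fin 2 => if i.val + j.val + 1 = 2 then (1 : L) else 0)).Local v)))]
          (m : OrbitalMeasureFamily ((UnitaryGroup.cmDatum L 2 (Matrix.of fun i j : Fin 2 => if i.val + j.val + 1 = 2 then (1 : L) else 0)).Local v)),
          m.IsCanonical (fun γ => IsRegularElt (γ.val : GL (Fin 2) (UnitaryGroup.LocalRing L v))) ν →
          ∀ γ : (cmDatum L 2 (Matrix.of fun i j : Fin 2 => if i.val + j.val + 1 = 2 then (1 : L) else 0)).Local v,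
      IsRegularElt (γ.val : GL (Fin 2) (UnitaryGroup.LocalRing L v)) →
      ¬ CompactSpace (Subgroup.centralizer ({γ} : Set ((cmDatum L 2 (Matrix.of fun i j : Fin 2 => if i.val + j.val + 1 = 2 then (1 : L) else 0)).Local v))) →
      (((ν ((((glInt 2 (w.1.adicCompletion L)).map (MulAut.conj D).toMonoidHom).comap
          (((unitaryGroupOfForm (galAdicCompletionMap (L := L) (IsCMField.complexConj L) hw)
            (placeForm (Matrix.of fun i j : Fin 2 => if i.val + j.val + 1 = 2 then (1 : L) else 0) w.1)).subtype.comp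
            (localNonsplitEquiv (IsCMField.complexConj L) (Matrix.of fun i j : Fin 2 => if i.val + j.val + 1 = 2 then (1 : L) else 0)
          (IsCMField.complexConj_ne_one L) w hw).toMonoidHom :
            (cmDatum L 2 (Matrix.of fun i j : Fin 2 => if i.val + j.val + 1 = 2 then (1 : L) else 0)).Local v →* GL (Fin 2) (w.1.adicCompletion L)))))).toReal : ℂ))⁻¹ *
          classOrbitalIntegral m
            ((((((glInt 2 (w.1.adicCompletion L)).map (MulAut.conj D).toMonoidHom).comap
          (((unitaryGroupOfForm (galAdicCompletionMap (L := L) (IsCMField.complexConj L) hw)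
            (placeForm (Matrix.of fun i j : Fin 2 => if i.val + j.val + 1 = 2 then (1 : L) else 0) w.1)).subtype.comp
            (localNonsplitEquiv (IsCMField.complexConj L) (Matrix.of fun i j : Fin 2 => if i.val + j.val + 1 = 2 then (1 : L) else 0)
          (IsCMField.complexConj_ne_one L) w hw).toMonoidHom :
            (cmDatum L 2 (Matrix.of fun i j : Fin 2 => if i.val + j.val + 1 = 2 then (1 : L) else 0)).Local v →* GL (Fin 2) (w.1.adicCompletion L)))) : Subgroup ((cmDatum L 2 (Matrix.of fun i j : Fin 2 => if i.val + j.val + 1 = 2 then (1 : L) else 0)).Local v)) : Set ((cmDatum L 2 (Matrix.of fun i j : Fin 2 => if i.val + j.val + 1 = 2 then (1 : L) else 0)).Local v)).indicator fun _ => (1 : ℂ))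
            (ConjClasses.mk γ) +
        (((ν (cmLocalIntegralLevel L 2 (Matrix.of fun i j : Fin 2 => if i.val + j.val + 1 = 2 then (1 : L) else 0) v)).toReal : ℂ))⁻¹ *
          classOrbitalIntegral m
            (((cmLocalIntegralLevel L 2 (Matrix.of fun i j : Fin 2 => if i.val + j.val + 1 = 2 then (1 : L) else 0) v) : Set ((cmDatum L 2 (Matrix.of fun i j : Fin 2 => if i.val + j.val + 1 = 2 then (1 : L) else 0)).Local v)).indicator fun _ => (1 : ℂ))
            (ConjClasses.mk γ) -
        (((ν ((((glInt 2 (w.1.adicCompletion L)).map (MulAut.conj D).toMonoidHom).comap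
          (((unitaryGroupOfForm (galAdicCompletionMap (L := L) (IsCMField.complexConj L) hw)
            (placeForm (Matrix.of fun i j : Fin 2 => if i.val + j.val + 1 = 2 then (1 : L) else 0) w.1)).subtype.comp
            (localNonsplitEquiv (IsCMField.complexConj L) (Matrix.of fun i j : Fin 2 => if i.val + j.val + 1 = 2 then (1 : L) else 0)
          (IsCMField.complexConj_ne_one L) w hw).toMonoidHom :
            (cmDatum L 2 (Matrix.of fun i j : Fin 2 => if i.val + j.val + 1 = 2 then (1 : L) else 0)).Local v →* GL (Fin 2) (w.1.adicCompletion L)))) ⊓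
            cmLocalIntegralLevel L 2 (Matrix.of fun i j : Fin 2 => if i.val + j.val + 1 = 2 then (1 : L) else 0) v)).toReal : ℂ))⁻¹ *
          classOrbitalIntegral m
            ((((((glInt 2 (w.1.adicCompletion L)).map (MulAut.conj D).toMonoidHom).comap
          (((unitaryGroupOfForm (galAdicCompletionMap (L := L) (IsCMField.complexConj L) hw)
            (placeForm (Matrix.of fun i j : Fin 2 => if i.val + j.val + 1 = 2 then (1 : L) else 0) w.1)).subtype.comp
            (localNonsplitEquiv (IsCMField.complexConj L) (Matrix.of fun i j : Fin 2 => if i.val + j.val + 1 = 2 then (1 : L) else 0)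
          (IsCMField.complexConj_ne_one L) w hw).toMonoidHom :
            (cmDatum L 2 (Matrix.of fun i j : Fin 2 => if i.val + j.val + 1 = 2 then (1 : L) else 0)).Local v →* GL (Fin 2) (w.1.adicCompletion L)))) ⊓
              cmLocalIntegralLevel L 2 (Matrix.of fun i j : Fin 2 => if i.val + j.val + 1 = 2 then (1 : L) else 0) v : Subgroup ((cmDatum L 2 (Matrix.of fun i j : Fin 2 => if i.val + j.val + 1 = 2 then (1 : L) else 0)).Local v)) : Set ((cmDatum L 2 (Matrix.of fun i j : Fin 2 => if i.val + j.val + 1 = 2 then (1 : L) else 0)).Local v)).indicator fun _ => (1 : ℂ))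
            (ConjClasses.mk γ) = 0) :
    RankOneEulerPoincareNonsplit := by
  refine rankOneEulerPoincareNonsplit_of_ramified (fun L _ _ _ v w hw hram => ?_)
  intro _ _ ν _ _ _ _ m hm
  have he := ramificationIdx'_ne_one_of_not_isUnramifiedIn_of_smul_eq' L w hw hram
  obtain ⟨D, hE, hN⟩ := hEN L v w hw he
  exact exists_isLocSmooth_classOrbitalIntegral_eq_one_zero_of_vertexEdgeLevels L w hw D ν hm hE (hN ν m hm)

end Literature.NumberTheory.Rogawski1990

end
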